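import Summits.AtomisticToContinuum.Crystallization.Theorems.SquareWellLayerCakeGapTwelveToBarlowGoodFacetsReduction

/-!
# Good facets — the one-deep fact MinDegFourFacets as a pure twelve-tuple statement
(crux `SquareWellLayerCake.GapTwelveToBarlow`, line `Sketch`, stub `stub_goodFacets`)

Companion of `…GapTwelveToBarlowGoodFacetsReduction` (which reduces `stub_goodFacets` to
FourCommon + MinDegFourFacets, both in site language).  Here the one-deep fact MinDegFourFacets is
extracted from a statement about twelve vectors only — the form in which it can be certified by
the shell-census replayer (`Literature/Geometry/DiscreteGeometry/ShellCensusReplay*`):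

**MinDegFourFacetsTuple.** Twelve vectors `v : Fin 12 → ℝ³` with norms in `[55/57, 1]`, pairwise
distances in `[55/57, 1] ∪ [11/10, ∞)`, every `v k` within distance `1` of at least four others;
`n` with `⟪n, v k⟫ ≤ 1` for all `k` and three distinct tight indices `⟪n, v a⟫ = ⟪n, v b⟫ =
⟪n, v c⟫ = 1`.  Then two of the three pairs `ab, bc, ca` are at distance `≤ 1`.
(Numerically robust: no violating tuple exists even with the dichotomy threshold lowered from
`11/10` to `1.04`; wave 5 report `work/stubs/goodFacets-REPORT-w5.md`.)

Contents: `minDegFacets_of_tuple` (registered anchor: the tuple statement implies the site-level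
MinDegFourFacets hypothesis of `goodFacets_of_fourCommon_of_minDegFacets`, by labelling the twelve
neighbours with `Finset.orderEmbOfFin`) and `goodFacets_of_fourCommon_of_minDegFacetsTuple`
(FourCommon → MinDegFourFacetsTuple → `stub_goodFacets` verbatim).
-/

noncomputable section

namespace Summit.AtomisticToContinuum.Crystallization.Theorems.SquareWellLayerCakeGapTwelveToBarlow

open Finset

/-- **MinDegFourFacets from the twelve-tuple statement** (registered anchor).  Hypothesis: the
pure statement MinDegFourFacetsTuple about twelve vectors (see the module docstring).  Conclusion:
the site-level MinDegFourFacets (a Good site with the `11/10` link dichotomy and all link degrees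
`≥ 4` has good facets), i.e. the second hypothesis of `goodFacets_of_fourCommon_of_minDegFacets`. -/
theorem minDegFacets_of_tuple :
    (∀ (v : Fin 12 → EuclideanSpace ℝ (Fin 3)) (n : EuclideanSpace ℝ (Fin 3)) (a b c : Fin 12),
      (∀ k : Fin 12, (55 : ℝ) / 57 ≤ ‖v k‖ ∧ ‖v k‖ ≤ 1) →
      (∀ k k' : Fin 12, k ≠ k' → (55 : ℝ) / 57 ≤ dist (v k) (v k') ∧
        (dist (v k) (v k') ≤ 1 ∨ (11 : ℝ) / 10 ≤ dist (v k) (v k'))) →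
      (∀ k : Fin 12, 4 ≤ (Finset.univ.filter fun k' : Fin 12 => k' ≠ k ∧ dist (v k) (v k') ≤ 1).card) →
      (∀ k : Fin 12, inner ℝ n (v k) ≤ 1) → a ≠ b → b ≠ c → a ≠ c →
      inner ℝ n (v a) = 1 → inner ℝ n (v b) = 1 → inner ℝ n (v c) = 1 →
      (dist (v a) (v b) ≤ 1 ∧ dist (v b) (v c) ≤ 1) ∨ (dist (v b) (v c) ≤ 1 ∧ dist (v c) (v a) ≤ 1) ∨
        (dist (v c) (v a) ≤ 1 ∧ dist (v a) (v b) ≤ 1)) →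
    ∀ (N : ℕ) (x : Fin N → EuclideanSpace ℝ (Fin 3)) (i : Fin N),
      ((∀ j' : Fin N, dist (x i) (x j') ≤ 11 / 10 → ∀ k : Fin N, k ≠ j' →
          (55 : ℝ) / 57 ≤ dist (x j') (x k)) ∧
        (Finset.univ.filter fun j' : Fin N => j' ≠ i ∧ dist (x i) (x j') ≤ 1).card = 12 ∧
        (Finset.univ.filter fun j' : Fin N => j' ≠ i ∧ dist (x i) (x j') ≤ 11 / 10).card ≤ 12) →
      (∀ l l' : Fin N, l ≠ i → l' ≠ i → dist (x i) (x l) ≤ 1 → dist (x i) (x l') ≤ 1 →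
        1 < dist (x l) (x l') → (11 : ℝ) / 10 ≤ dist (x l) (x l')) →
      (∀ a : Fin N, a ≠ i → dist (x i) (x a) ≤ 1 →
        4 ≤ (Finset.univ.filter fun k : Fin N =>
          k ≠ i ∧ k ≠ a ∧ dist (x i) (x k) ≤ 1 ∧ dist (x a) (x k) ≤ 1).card) →
      ∀ (n : EuclideanSpace ℝ (Fin 3)) (a b c : Fin N),
        (∀ l : Fin N, l ≠ i → dist (x i) (x l) ≤ 1 → inner ℝ n (x l - x i) ≤ 1) →
        a ≠ i → b ≠ i → c ≠ i → a ≠ b → b ≠ c → a ≠ c →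
        dist (x i) (x a) ≤ 1 → dist (x i) (x b) ≤ 1 → dist (x i) (x c) ≤ 1 →
        inner ℝ n (x a - x i) = 1 → inner ℝ n (x b - x i) = 1 → inner ℝ n (x c - x i) = 1 →
        (dist (x a) (x b) ≤ 1 ∧ dist (x b) (x c) ≤ 1) ∨ (dist (x b) (x c) ≤ 1 ∧ dist (x c) (x a) ≤ 1) ∨
          (dist (x c) (x a) ≤ 1 ∧ dist (x a) (x b) ≤ 1) := by
  classical
  intro htup N x i hGood hdich hdeg n a b c hsupp hai hbi hci hab hbc hac hia hib hic hta htb htc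
  -- the twelve neighbours, labelled by `Fin 12`
  set Nb := Finset.univ.filter fun j' : Fin N => j' ≠ i ∧ dist (x i) (x j') ≤ 1 with hNb
  have h12 : Nb.card = 12 := hGood.2.1
  set e : Fin 12 → Fin N := fun k => Nb.orderEmbOfFin h12 k
  have heNb : ∀ k, e k ∈ Nb := fun k => Finset.orderEmbOfFin_mem Nb h12 k
  have hemem : ∀ k, e k ≠ i ∧ dist (x i) (x (e k)) ≤ 1 := by
    intro k
    have h := heNb k
    rw [hNb, Finset.mem_filter] at h
    exact h.2
  have heinj : Function.Injective e := fun k k' h => (Nb.orderEmbOfFin h12).injective h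
  have hesurj : ∀ l : Fin N, l ≠ i → dist (x i) (x l) ≤ 1 → ∃ k, e k = l := by
    intro l hli hil
    have hl : l ∈ (Nb : Set (Fin N)) := by
      rw [Finset.mem_coe, hNb, Finset.mem_filter]
      exact ⟨Finset.mem_univ _, hli, hil⟩
    rw [← Finset.range_orderEmbOfFin Nb h12] at hl
    obtain ⟨k, hk⟩ := hl
    exact ⟨k, hk⟩
  -- hard core at `i` and at the link sites
  have hcore_i : ∀ k, (55 : ℝ) / 57 ≤ dist (x i) (x (e k)) := fun k =>
    hGood.1 i (by rw [dist_self]; norm_num) (e k) (hemem k).1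
  have hcore_l : ∀ k k', k ≠ k' → (55 : ℝ) / 57 ≤ dist (x (e k)) (x (e k')) := by
    intro k k' hkk'
    have hne : e k' ≠ e k := fun h => hkk' (heinj h).symm
    exact hGood.1 (e k) ((hemem k).2.trans (by norm_num)) (e k') hne
  -- the relative tuple
  set v : Fin 12 → EuclideanSpace ℝ (Fin 3) := fun k => x (e k) - x i with hv
  have hvdist : ∀ k k', dist (v k) (v k') = dist (x (e k)) (x (e k')) := by
    intro k k'
    simp only [hv, dist_eq_norm, sub_sub_sub_cancel_right]
  have hvnorm : ∀ k, ‖v k‖ = dist (x i) (x (e k)) := by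
    intro k
    rw [hv, dist_comm, dist_eq_norm]
  have H1 : ∀ k : Fin 12, (55 : ℝ) / 57 ≤ ‖v k‖ ∧ ‖v k‖ ≤ 1 := fun k => by
    rw [hvnorm]; exact ⟨hcore_i k, (hemem k).2⟩
  have H2 : ∀ k k' : Fin 12, k ≠ k' → (55 : ℝ) / 57 ≤ dist (v k) (v k') ∧
      (dist (v k) (v k') ≤ 1 ∨ (11 : ℝ) / 10 ≤ dist (v k) (v k')) := by
    intro k k' hkk'
    rw [hvdist]
    refine ⟨hcore_l k k' hkk', ?_⟩
    by_cases hle : dist (x (e k)) (x (e k')) ≤ 1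
    · exact Or.inl hle
    · exact Or.inr (hdich (e k) (e k') (hemem k).1 (hemem k').1 (hemem k).2 (hemem k').2
        (lt_of_not_ge hle))
  have H3 : ∀ k : Fin 12,
      4 ≤ (Finset.univ.filter fun k' : Fin 12 => k' ≠ k ∧ dist (v k) (v k') ≤ 1).card := by
    intro k
    set C := Finset.univ.filter fun l : Fin N =>
      l ≠ i ∧ l ≠ e k ∧ dist (x i) (x l) ≤ 1 ∧ dist (x (e k)) (x l) ≤ 1 with hC
    set F := Finset.univ.filter fun k' : Fin 12 => k' ≠ k ∧ dist (v k) (v k') ≤ 1 with hF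
    have h4 : 4 ≤ C.card := hdeg (e k) (hemem k).1 (hemem k).2
    have hsubset : C ⊆ F.image e := by
      intro l hl
      rw [hC, Finset.mem_filter] at hl
      obtain ⟨k', hk'⟩ := hesurj l hl.2.1 hl.2.2.2.1
      rw [Finset.mem_image]
      refine ⟨k', ?_, hk'⟩
      rw [hF, Finset.mem_filter]
      refine ⟨Finset.mem_univ _, ?_, ?_⟩
      · rintro rfl
        exact hl.2.2.1 hk'.symm
      · rw [hvdist, hk']
        exact hl.2.2.2.2
    calc 4 ≤ C.card := h4
      _ ≤ (F.image e).card := Finset.card_le_card hsubset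
      _ ≤ F.card := Finset.card_image_le
  have H4 : ∀ k : Fin 12, inner ℝ n (v k) ≤ 1 := fun k => hsupp (e k) (hemem k).1 (hemem k).2
  -- the three tight sites as labels
  obtain ⟨ka, hka⟩ := hesurj a hai hia
  obtain ⟨kb, hkb⟩ := hesurj b hbi hib
  obtain ⟨kc, hkc⟩ := hesurj c hci hic
  have hkab : ka ≠ kb := by rintro rfl; exact hab (hka.symm.trans hkb)
  have hkbc : kb ≠ kc := by rintro rfl; exact hbc (hkb.symm.trans hkc)
  have hkac : ka ≠ kc := by rintro rfl; exact hac (hka.symm.trans hkc)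
  have hva : v ka = x a - x i := by rw [hv]; simp only [hka]
  have hvb : v kb = x b - x i := by rw [hv]; simp only [hkb]
  have hvc : v kc = x c - x i := by rw [hv]; simp only [hkc]
  have h := htup v n ka kb kc H1 H2 H3 H4 hkab hkbc hkac (by rw [hva]; exact hta)
    (by rw [hvb]; exact htb) (by rw [hvc]; exact htc)
  rw [hvdist, hvdist, hvdist, hka, hkb, hkc] at h
  exact h

/-- **`stub_goodFacets` from FourCommon and the twelve-tuple statement.**  FourCommon (at a
four-deep Good site a bonded pair has at least four common neighbours within distance `1`) and
MinDegFourFacetsTuple imply the registered signature of `stub_goodFacets` verbatim. -/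
theorem goodFacets_of_fourCommon_of_minDegFacetsTuple
    (hfour : ∀ (N : ℕ) (x : Fin N → EuclideanSpace ℝ (Fin 3)) (i a : Fin N),
      (∀ l : Fin N, dist (x i) (x l) ≤ 4 →
        ((∀ j' : Fin N, dist (x l) (x j') ≤ 11 / 10 → ∀ k : Fin N, k ≠ j' →
            (55 : ℝ) / 57 ≤ dist (x j') (x k)) ∧
          (Finset.univ.filter fun j' : Fin N => j' ≠ l ∧ dist (x l) (x j') ≤ 1).card = 12 ∧
          (Finset.univ.filter fun j' : Fin N => j' ≠ l ∧ dist (x l) (x j') ≤ 11 / 10).card ≤ 12)) →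
      a ≠ i → dist (x i) (x a) ≤ 1 →
      4 ≤ (Finset.univ.filter fun k : Fin N =>
        k ≠ i ∧ k ≠ a ∧ dist (x i) (x k) ≤ 1 ∧ dist (x a) (x k) ≤ 1).card)
    (htup : ∀ (v : Fin 12 → EuclideanSpace ℝ (Fin 3)) (n : EuclideanSpace ℝ (Fin 3)) (a b c : Fin 12),
      (∀ k : Fin 12, (55 : ℝ) / 57 ≤ ‖v k‖ ∧ ‖v k‖ ≤ 1) →
      (∀ k k' : Fin 12, k ≠ k' → (55 : ℝ) / 57 ≤ dist (v k) (v k') ∧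
        (dist (v k) (v k') ≤ 1 ∨ (11 : ℝ) / 10 ≤ dist (v k) (v k'))) →
      (∀ k : Fin 12, 4 ≤ (Finset.univ.filter fun k' : Fin 12 => k' ≠ k ∧ dist (v k) (v k') ≤ 1).card) →
      (∀ k : Fin 12, inner ℝ n (v k) ≤ 1) → a ≠ b → b ≠ c → a ≠ c →
      inner ℝ n (v a) = 1 → inner ℝ n (v b) = 1 → inner ℝ n (v c) = 1 →
      (dist (v a) (v b) ≤ 1 ∧ dist (v b) (v c) ≤ 1) ∨ (dist (v b) (v c) ≤ 1 ∧ dist (v c) (v a) ≤ 1) ∨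
        (dist (v c) (v a) ≤ 1 ∧ dist (v a) (v b) ≤ 1)) :
    ∀ (N : ℕ) (x : Fin N → EuclideanSpace ℝ (Fin 3)) (i : Fin N), (∀ l : Fin N, dist (x i) (x l) ≤
    4 → ((∀ j' : Fin N, dist (x l) (x j') ≤ 11 / 10 → ∀ k : Fin N, k ≠ j' → (55 : ℝ) / 57 ≤ dist (x
    j') (x k)) ∧ (Finset.univ.filter fun j' : Fin N => j' ≠ l ∧ dist (x l) (x j') ≤ 1).card = 12 ∧
    (Finset.univ.filter fun j' : Fin N => j' ≠ l ∧ dist (x l) (x j') ≤ 11 / 10).card ≤ 12)) → ∀ (n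
    : EuclideanSpace ℝ (Fin 3)) (a b c : Fin N), (∀ l : Fin N, l ≠ i → dist (x i) (x l) ≤ 1 → inner
    ℝ n (x l - x i) ≤ 1) → a ≠ i → b ≠ i → c ≠ i → a ≠ b → b ≠ c → a ≠ c → dist (x i) (x a) ≤ 1 →
    dist (x i) (x b) ≤ 1 → dist (x i) (x c) ≤ 1 → inner ℝ n (x a - x i) = 1 → inner ℝ n (x b - x i)
    = 1 → inner ℝ n (x c - x i) = 1 → (dist (x a) (x b) ≤ 1 ∧ dist (x b) (x c) ≤ 1) ∨ (dist (x b)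
    (x c) ≤ 1 ∧ dist (x c) (x a) ≤ 1) ∨ (dist (x c) (x a) ≤ 1 ∧ dist (x a) (x b) ≤ 1) :=
  goodFacets_of_fourCommon_of_minDegFacets hfour (minDegFacets_of_tuple htup)

end Summit.AtomisticToContinuum.Crystallization.Theorems.SquareWellLayerCakeGapTwelveToBarlow

end
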